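import Mathlib.Analysis.SpecialFunctions.Pow.Real
import Mathlib.Analysis.Asymptotics.Defs
import Mathlib.Data.Finset.SymmDiff
import Mathlib.Order.Filter.AtTopBot.Defs
import Literature.Probability.LatticeModels.LoomisWhitney
import HarnessLib

/-!
# Maximal fluctuations of edge-isoperimetric sets in `ℤ³` and `ℤ^d` around the cubic Wulff shape
# (Mainini–Piovano–Schmidt–Stefanelli 2019; Mainini–Schmidt 2020)

Topic `Literature/MathematicalPhysics/StatisticalMechanics` (the cubic-lattice companion of
`StickyWulffConstants.lean`, which records the fcc/hcp sticky-sphere Wulff constants of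
Cicalese–Kreutz–Leonardi 2023).  Cell `crystal3d-full` (D-0046), cross-ladder literature-typing
layer D-0088 (4), seat `littype-FC1-1`; consumers: the crux items `StackingLiminf` /
`NoReconstructionGain` of `Summits/Ventures/Crystal3D/Theses/StickyWulffConstant.lean`, for which the
results below are the CUBIC-LATTICE ANALOGUES (sections of minimizers are minimizers, slab-shaped
minimizers, the sharp fluctuation law) — nothing here is about fcc/hcp or off-lattice configurations.

## The edge-isoperimetric problem in `ℤ^d` in the tree's vocabulary

Both sources work in `ℤ^d = {k₁e₁ + ⋯ + k_de_d}` with the *edge boundary*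
`Θ_d(C) := {(x, y) ∈ ℤ^d × ℤ^d : |x − y| = 1, x ∈ C, y ∉ C}` of a finite `C ⊂ ℤ^d`, the *edge
perimeter* `#Θ_d(C)`, `EIP^d(n) := min {#Θ_d(C) : C ⊂ ℤ^d, #C = n}`, and call `C` an *`EIP^d`
minimizer* when `#Θ_d(C) = EIP^d(#C)` ("as a convention, the empty set is assumed to be an `EIP^d`
minimizer as well") [MaininiSchmidt2020, §1]; [MaininiPiovanoSchmidtStefanelli2019, §1 (d = 3)].
The tree already has all of this (we REUSE it, nothing is re-declared):
* `Literature.Probability.LatticeModels.Site d = (Fin d → ℤ)` and the nearest-neighbour graph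
  `zdGraph d` (`LatticeGraph.lean`; adjacency iff `ℓ¹`-distance `1`, `zdGraph_adj_iff_norm_holds`,
  which for integer points is the sources' Euclidean `|x − y| = 1`);
* `Literature.Probability.LatticeModels.boundaryPairs C : Finset (Site d × Fin d × Bool)` — the
  directed boundary edges `(x, ±eᵢ)` with `x ∈ C`, `x ± eᵢ ∉ C` (`DiscreteIsoperimetry.lean`).  Since
  the `2d` steps `±eᵢ` are pairwise distinct, `(x, i, ±) ↦ (x, x ± eᵢ)` is a bijection onto `Θ_d(C)`,
  so **`#Θ_d(C) = #(boundaryPairs C)`**; the literal count "pairs `(x, y)`, `x ∈ C`, `y ∉ C`,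
  `x ∼ y`" is recovered in `card_boundaryPairs_eq_sum_card_filter_neighborFinset` (proved below);
* the sharp edge-isoperimetric inequality `2d·#C^{(d−1)/d} ≤ #(boundaryPairs C)` is the proved
  theorem `two_mul_card_mul_rpow_le_card_boundaryPairs` (`LoomisWhitney.lean`), with equality on cubes —
  consistent with the cubic Wulff shapes below.

## Sources, as printed (tex of the arXiv versions held in the hub store; locators = theorem numbers)

**[MPSS19]** E. Mainini, P. Piovano, B. Schmidt, U. Stefanelli, *`N^{3/4}` law in the cubic lattice*,
J. Stat. Phys. 176 (2019) 1480–1499 = arXiv:1807.00811 [MaininiPiovanoSchmidtStefanelli2019]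
(store key `paper:arxiv-1807.00811`).  §1: `W_n := [0, ℓ_n]³ ∩ ℤ³`, `ℓ_n := ⌊∛n⌋`, "the Wulff shape".
* **Theorem 1.1 (Upper Bound).** "There exists a constant `K₁ > 0` independent of `n` such that
  `min_{a ∈ ℤ³} #(M_n △ (a + W_n)) ≤ K₁ n^{3/4} + o(n^{3/4})` for every `n ∈ ℕ` and every minimizer `M_n`
  of the `EIP_n`."
* **Theorem 1.2 (Lower Bound).** "There exists a sequence of minimizers `M_{n_i}` with a diverging
  number `n_i ∈ ℕ` of particles such that `min_{a ∈ ℤ³} #(M_{n_i} △ (a + W_{n_i})) ≥ K₂ n_i^{3/4} + o(n_i^{3/4})`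
  for some constant `K₂ > 0` (not depending on `n_i`)."
* §2: `b(C_n) := ½ #{(x, y) ∈ C_n × C_n : |x − y| = 1}` and "the elementary relation
  `#Θ(C_n) + 2b(C_n) = 6n` shows that `C_n` is a minimizer for the `EIP_n` if and only if it maximizes
  the number of unit bonds" (this is how the results transfer to sticky-type ground states).

**[MS20]** E. Mainini, B. Schmidt, *Maximal fluctuations around the Wulff shape for edge-isoperimetric
sets in `ℤ^d`: a sharp scaling law*, Comm. Math. Phys. 380 (2020) 947–971 = arXiv:2003.01679
[MaininiSchmidt2020] (store key `paper:arxiv-2003.01679`).  §1: `W_n = {1, …, ⌊n^{1/d}⌋}^d`.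
* **Theorem 1.1.** "There is a constant `K_d > 0` which only depends on the dimension `d` such that
  (i) for every `n ∈ ℕ` and each solution `C` to `EIP^d(n)` there is a translation vector `a ∈ ℤ^d`
  such that `#(C − a) △ W_n ≤ K_d n^{(d−1+2^{1−d})/d}`.  (ii) This estimate is sharp as for each `ε > 0`
  there are infinitely many `n ∈ ℕ` for which a solution `C` to `EIP^d(n)` exists which satisfies the
  estimate `inf_{a ∈ ℤ^d} #(C − a) △ W_n ≥ (K_d − ε) n^{(d−1+2^{1−d})/d}`."  The exponents are
  `3/4, 3/4, 25/32, 13/16, …` for `d = 2, 3, 4, 5, …` (p. 3; `maximalFluctuationExponent_two/_three` below).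
* **Definition 3.1.** `h_{ℓ,d} := ℓ^{2^{1−d}}`.  **Corollary 3.3.** "Let `C` be an `EIP^d` minimizer. Then
  each `(d−1)`-dimensional section is an `EIP^{d−1}` minimizer."  (Sections `S_{s,k}(C) = C ∩ {x_s = k}`,
  identified with `ℤ^{d−1}` by dropping the `s`-th coordinate, Definition 2.11.)
* **Lemma 3.5.** "Let `d ∈ {2, 3, …}`. Let `ℓ ∈ ℕ`. The configuration
  `P_{ℓ,d,p} := {1, …, ℓ − p} × {1, …, ℓ}^{d−1}` is an `EIP^d` minimizer for any `p ∈ ℕ` such that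
  `p ≤ ⌊h_{ℓ,d}⌋`."  (The construction behind (ii): a minimizer missing a whole slab of thickness
  `ℓ^{2^{1−d}}` from the cube.)

## Typing decisions (read before using the facts)

1. `o(n^{3/4})` in [MPSS19] is rendered by an explicit remainder `r` with `r =o[atTop] (n ↦ n^{3/4})`
   (Mathlib `Asymptotics.IsLittleO`), uniform in the minimizer (the only meaningful reading: for
   fixed `n` there are finitely many minimizers up to translation).  `min_{a ∈ ℤ³} … ≤ B` is `∃ a, … ≤ B`
   and `min_a … ≥ B` / `inf_a … ≥ B` is `∀ a, B ≤ …` (the minimum over `a` of a natural number exists).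
2. [MS20] Theorem 1.1 quantifies ONE constant `K_d` over both clauses, i.e. (ii) is stated for the
   sharp constant of (i).  The printed proof (§4, "(ii) This follows directly from Lemma 3.5") gives
   (i) with the constant of Corollary 4.8 and (ii) with the constant of the slab construction, so we
   vendor the two clauses as TWO named facts `MaininiSchmidt2020_thm11_upper` / `_lower`, each with
   its own constant — each is implied by the printed theorem; the shared-constant conjunction is
   deliberately not vendored.  In `_lower` the standalone reading `∃ K > 0, ∀ ε > 0, …(K − ε)…` is kept
   verbatim (it is equivalent to `∃ K' > 0` with `K'` in place of `K − ε`).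
3. Dimension ranges: [MS20] writes "`d ∈ ℕ`"; clause (i) is typed for `1 ≤ d`; clause (ii) and
   Lemma 3.5 for `2 ≤ d` as in §3 ("`d ∈ {2, 3, …}`") — for `d = 1` every minimizer is an interval,
   a translate of `W_n`, so (ii) would fail trivially.  In Lemma 3.5 we take `ℓ ≥ 1`, `p ≥ 1`
   (the source's `ℕ`); `p ≥ ℓ` gives the empty configuration, a minimizer by the printed convention
   (`isEIPMinimizer_empty`).
4. `⌊n^{1/d}⌋`, `⌊∛n⌋`, `⌊ℓ^{2^{1−d}}⌋` are literal `Nat.floor`s of real powers (`latticeRootFloor`);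
   `latticeRootFloor_pow_le` / `lt_latticeRootFloor_succ_pow` pin `latticeRootFloor d n` down as the
   integer `ℓ` with `ℓ^d ≤ n < (ℓ+1)^d`.  The two sources' Wulff cubes differ (`{0,…,ℓ_n}³` with
   `(ℓ_n+1)³` points in [MPSS19], `{1,…,ℓ_n}^d` in [MS20]); each fact uses its own source's cube.

## Contents (namespace `Literature.MathematicalPhysics.StatisticalMechanics`)

Definitions `IsEIPMinimizer`, `latticeRootFloor`, `wulffCube` ([MS20] `W_n`), `wulffCubeZero`
([MPSS19] `W_n`), `maximalFluctuationExponent`, `latticeSection`, `slabConfig`; proved bookkeeping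
`isEIPMinimizer_empty`, `isEIPMinimizer_singleton`, `card_boundaryPairs_eq_sum_card_filter_neighborFinset`,
`card_boundaryPairs_add_card_adjPairs` (the relation `#Θ_d + 2b = 2d·#C`) with
`IsEIPMinimizer.card_adjPairs_le` (minimizers maximize bonds), `card_wulffCube`,
`card_wulffCubeZero`, `latticeRootFloor_pow_le`, `lt_latticeRootFloor_succ_pow`,
`maximalFluctuationExponent_two`, `maximalFluctuationExponent_three`; NAMED FACTS (statements as
printed, not proved in this file): `MaininiPiovanoSchmidtStefanelli2019_thm11`, `…_thm12`,
`MaininiSchmidt2020_thm11_upper`, `…_thm11_lower`, `…_cor33`, `…_lemma35`.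

STATUS OF THE NAMED FACTS (companion files downstream of this one, everything there PROVED):
BOTH [MPSS19] facts are DISCHARGED — `MaininiPiovanoSchmidtStefanelli2019_thm12_holds` in
`CubicLatticeEdgeIsoperimetry.lean`, which solves the edge-isoperimetric problem in `ℤ³`
(`isEIPMinimizer_iff_card_boundaryPairs_eq_three`: `EIP³(n) = 2(F + m⌈2√F⌉ + ⌈2√r⌉)`), and
`MaininiPiovanoSchmidtStefanelli2019_thm11_holds` (the `N^{3/4}` law itself) in
`CubicLatticeSideFace.lean`, the end of the development `CubicLatticeFluctuations.lean` →
`CubicLatticeSideFace.lean` which follows [MPSS19] §3 (no gaps, the box of a minimizer,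
cuboidification as exchange moves on slice multisets, the fourth-order cancellation of Step 3, the
bounding-box estimate (3.2)); feed users' hypotheses `(h : MaininiPiovanoSchmidtStefanelli2019_thm11)`
/ `(h : …_thm12)` with them.  THREE of the four `∀ d` facts of [MS20] are DISCHARGED downstream, in
every dimension: `MaininiSchmidt2020_cor33_holds` in `GridEdgeIsoperimetry.lean` (the end of
`EIPMinimizerSections` → `EIPSliceRecursion` → `GridCubicles` → `GridEdgeIsoperimetry`, which follows
Agnarsson–Lauria 2013 §2–§6: `eipValue_eq_cubicleCost` is their Theorem 6.4 `EIP^d(n) = 2δ_d(n)`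
and `exists_isNestedMinimizerFamily` gives nested `EIP^d` solutions in every `ℤ^d`, i.e. [MS20]
Theorem 2.2 / Ahlswede–Bezrukov in family form), `MaininiSchmidt2020_lemma35_holds` and
`MaininiSchmidt2020_thm11_lower_holds` in `EIPSlabMinimizers.lean` ([MS20] Lemma 3.4–3.5 and
Theorem 1.1 (ii) with cubicles in place of daisies, `K_d = 1/(2d)`); feed users' hypotheses
`(h : MaininiSchmidt2020_cor33)` / `(h : …_lemma35)` / `(h : …_thm11_lower)` with them.  The
low-dimensional instances `MaininiSchmidt2020_thm11_lower_two` / `_three`,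
`MaininiSchmidt2020_thm11_upper_two` (the planar `n^{3/4}` law, upper direction),
`MaininiSchmidt2020_thm11_upper_three` (`CubicLatticeSideFace`), `MaininiSchmidt2020_lemma35_two` /
`_three`, `MaininiSchmidt2020_cor33_two` / `_three` / `_four` (files `SquareLatticeEdgeIsoperimetry`,
`EIPMinimizerSections`, `CubicLatticeEdgeIsoperimetry`) remain available.  Still a named fact with no
proof in the tree: `MaininiSchmidt2020_thm11_upper` for general `d` ([MS20] Theorem 1.1 (i), §4:
defects of daisies).

WHAT IS NOT HERE (nor downstream): the Ahlswede–Bezrukov ORDER itself and the daisies in general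
`d` ([MS20] Def. 2.1–2.4, Thm 2.9; Thm 2.2 is downstream only in family form,
`GridEdgeIsoperimetry.exists_isNestedMinimizerFamily`), [MS20] §4 (defects; Theorem 1.1 (i) for
`d ≥ 4`), [MS20] Lemma 3.6 (whose literal statement needs `2p < ℓ`), the
bounded-Lipschitz convergence rate of [MS20] p. 3, the printed values of the constants `K₁`, `K₂`.
(Downstream instead: the bounding-box claim (3.2) of [MPSS19] §3 in the form
`IsEIPMinimizer.exists_box_dev_of_quasicube` + `sideFace_height_pow_four_le` and the `N^{5/6}`
law `MaininiPiovanoSchmidtStefanelli2019_thm11_weak` with explicit constants —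
`CubicLatticeFluctuations` / `CubicLatticeSideFace`; the daisies and the decreasing rearrangement of [MS20] Prop. 3.2 —
`EIPMinimizerSections`; the two-dimensional characterisation `b = ⌊2n − 2√n⌋` of
Mainini–Piovano–Stefanelli 2014 and [MPSS19] Lemma 4.1 — `SquareLatticeEdgeIsoperimetry`; nested
solutions in `ℤ³`, i.e. [MS20] Thm 2.2 at `d = 3` — `CubicLatticeEdgeIsoperimetry`; nested solutions
and `EIP^d = 2δ_d` in every `ℤ^d` — `EIPSliceRecursion` / `GridCubicles` / `GridEdgeIsoperimetry`; the
slabs `P_{ℓ,d,p}` in every dimension — `EIPSlabMinimizers`.)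
-/

noncomputable section

open Finset Filter Asymptotics
open scoped symmDiff

namespace Literature.MathematicalPhysics.StatisticalMechanics

open Literature.Probability.LatticeModels

variable {d : ℕ}

/-! ### Definitions -/

/-- `C ⊂ ℤ^d` is an **`EIP^d` minimizer**: its edge perimeter `#Θ_d(C) = #(boundaryPairs C)` is
minimal among all subsets of `ℤ^d` of the same cardinality, i.e. `#Θ_d(C) = EIP^d(#C)`; the empty set
qualifies, matching the printed convention. [cite: MaininiSchmidt2020, §1 (definition of EIP^d(n) and of EIP^d minimizers)] -/
def IsEIPMinimizer (C : Finset (Site d)) : Prop :=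
  ∀ C' : Finset (Site d), #C' = #C → #(boundaryPairs C) ≤ #(boundaryPairs C')

/-- `⌊n^{1/d}⌋`, the side (number of points per edge) of the cubic Wulff shape of `n` points in `ℤ^d`
(`⌊∛n⌋ = ℓ_n` for `d = 3`); characterised for `d ≥ 1` by `ℓ^d ≤ n < (ℓ+1)^d`
(`latticeRootFloor_pow_le`, `lt_latticeRootFloor_succ_pow`); for `d = 0` the junk value `⌊n⁰⌋ = 1`.
[cite: MaininiSchmidt2020, §1 (W_n = {1,…,⌊n^{1/d}⌋}^d)] -/
def latticeRootFloor (d n : ℕ) : ℕ := ⌊(n : ℝ) ^ ((1 : ℝ) / d)⌋₊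

/-- The cubic **Wulff shape** `W_n = {1, …, ⌊n^{1/d}⌋}^d ⊂ ℤ^d` of Mainini–Schmidt.
[cite: MaininiSchmidt2020, §1 (W_n)] -/
def wulffCube (d n : ℕ) : Finset (Site d) :=
  Fintype.piFinset fun _ : Fin d => Finset.Icc (1 : ℤ) (latticeRootFloor d n)

/-- The cubic **Wulff shape** `W_n = [0, ℓ_n]³ ∩ ℤ³`, `ℓ_n = ⌊∛n⌋`, of Mainini–Piovano–Schmidt–Stefanelli
(note: `(ℓ_n + 1)³` points). [cite: MaininiPiovanoSchmidtStefanelli2019, §1 eq. (2) (W_n, ℓ_n)] -/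
def wulffCubeZero (n : ℕ) : Finset (Site 3) :=
  Fintype.piFinset fun _ : Fin 3 => Finset.Icc (0 : ℤ) (latticeRootFloor 3 n)

/-- The sharp fluctuation exponent `(d − 1 + 2^{1−d})/d` of Mainini–Schmidt (`3/4, 3/4, 25/32, 13/16, …`
for `d = 2, 3, 4, 5, …`). [cite: MaininiSchmidt2020, Theorem 1.1 and p. 3] -/
def maximalFluctuationExponent (d : ℕ) : ℝ :=
  ((d : ℝ) - 1 + (2 : ℝ) ^ (1 - (d : ℝ))) / d

/-- The `(d−1)`-dimensional **section** `S_{s,k}(C) = C ∩ {x_s = k}` of `C ⊂ ℤ^{d}` (`d = n + 1`),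
identified with a subset of `ℤ^{d−1}` by dropping the `s`-th coordinate
(`P(z₁,…,z_d) = (z₁,…,z_{s−1},z_{s+1},…,z_d)`). [cite: MaininiSchmidt2020, Definition 2.11 and Proposition 3.2] -/
def latticeSection {n : ℕ} (s : Fin (n + 1)) (k : ℤ) (C : Finset (Site (n + 1))) : Finset (Site n) :=
  (C.filter fun z => z s = k).image (Fin.removeNth s)

/-- The slab-deficient cube `P_{ℓ,d,p} := {1, …, ℓ − p} × {1, …, ℓ}^{d−1} ⊂ ℤ^d` (first coordinate
shortened by `p`; empty when `p ≥ ℓ`). [cite: MaininiSchmidt2020, Lemma 3.5] -/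
def slabConfig (d ℓ p : ℕ) : Finset (Site d) :=
  Fintype.piFinset fun i : Fin d =>
    if (i : ℕ) = 0 then Finset.Icc (1 : ℤ) ((ℓ : ℤ) - p) else Finset.Icc (1 : ℤ) ℓ

/-! ### Named facts (statements as printed; all but `MaininiSchmidt2020_thm11_upper` are discharged downstream) -/

/-- **Mainini–Piovano–Schmidt–Stefanelli 2019, Theorem 1.1 (Upper Bound), NAMED FACT.**  There is
`K₁ > 0` independent of `n` such that `min_{a ∈ ℤ³} #(M_n △ (a + W_n)) ≤ K₁ n^{3/4} + o(n^{3/4})` for every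
`n` and every minimizer `M_n` of the edge-isoperimetric problem among `n`-point subsets of `ℤ³`
(`W_n = [0, ⌊∛n⌋]³ ∩ ℤ³`; the `o(n^{3/4})` is an explicit remainder `r =o (n ↦ n^{3/4})`, uniform in the
minimizer). [cite: MaininiPiovanoSchmidtStefanelli2019, Theorem 1.1] -/
def MaininiPiovanoSchmidtStefanelli2019_thm11 : Prop :=
  ∃ K₁ : ℝ, 0 < K₁ ∧ ∃ r : ℕ → ℝ, (r =o[atTop] fun n : ℕ => (n : ℝ) ^ ((3 : ℝ) / 4)) ∧
    ∀ (n : ℕ) (M : Finset (Site 3)), IsEIPMinimizer M → #M = n →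
      ∃ a : Site 3,
        (#(M ∆ ((wulffCubeZero n).image fun w => a + w)) : ℝ) ≤ K₁ * (n : ℝ) ^ ((3 : ℝ) / 4) + r n

/-- **Mainini–Piovano–Schmidt–Stefanelli 2019, Theorem 1.2 (Lower Bound), NAMED FACT.**  There are a
constant `K₂ > 0` and a sequence of minimizers `M_{n_i}` of the edge-isoperimetric problem in `ℤ³` with
`n_i → ∞` particles such that `min_{a ∈ ℤ³} #(M_{n_i} △ (a + W_{n_i})) ≥ K₂ n_i^{3/4} + o(n_i^{3/4})`: the
exponent `3/4` of Theorem 1.1 cannot be lowered. [cite: MaininiPiovanoSchmidtStefanelli2019, Theorem 1.2] -/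
def MaininiPiovanoSchmidtStefanelli2019_thm12 : Prop :=
  ∃ K₂ : ℝ, 0 < K₂ ∧ ∃ (nseq : ℕ → ℕ) (M : ℕ → Finset (Site 3)) (r : ℕ → ℝ),
    Tendsto nseq atTop atTop ∧ (r =o[atTop] fun i : ℕ => (nseq i : ℝ) ^ ((3 : ℝ) / 4)) ∧
    ∀ i : ℕ, IsEIPMinimizer (M i) ∧ #(M i) = nseq i ∧
      ∀ a : Site 3,
        K₂ * (nseq i : ℝ) ^ ((3 : ℝ) / 4) + r i ≤
          (#(M i ∆ ((wulffCubeZero (nseq i)).image fun w => a + w)) : ℝ)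

/-- **Mainini–Schmidt 2020, Theorem 1.1 (i), NAMED FACT.**  For every dimension `d` there is `K_d > 0`
such that for every `n` and each solution `C` of `EIP^d(n)` (an `n`-point `EIP^d` minimizer) there is a
translation `a ∈ ℤ^d` with `#((C − a) △ W_n) ≤ K_d · n^{(d−1+2^{1−d})/d}`, `W_n = {1,…,⌊n^{1/d}⌋}^d`.
(Typed for `1 ≤ d`; see the module docstring, decision 2, for why (i) and (ii) are separate facts.)
[cite: MaininiSchmidt2020, Theorem 1.1 (i)] -/
def MaininiSchmidt2020_thm11_upper : Prop :=
  ∀ d : ℕ, 1 ≤ d → ∃ K : ℝ, 0 < K ∧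
    ∀ (n : ℕ) (C : Finset (Site d)), IsEIPMinimizer C → #C = n →
      ∃ a : Site d,
        (#((C.image fun x => x - a) ∆ wulffCube d n) : ℝ) ≤ K * (n : ℝ) ^ maximalFluctuationExponent d

/-- **Mainini–Schmidt 2020, Theorem 1.1 (ii) (sharpness), NAMED FACT.**  For every `d ≥ 2` there is
`K_d > 0` such that for each `ε > 0` there are infinitely many `n` for which a solution `C` of `EIP^d(n)`
exists with `inf_{a ∈ ℤ^d} #((C − a) △ W_n) ≥ (K_d − ε) · n^{(d−1+2^{1−d})/d}`.  (Standalone reading with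
its own constant — module docstring, decision 2; `d ≥ 2` as in §3 of the source, decision 3.)
DISCHARGED downstream: `EIPSlabMinimizers.MaininiSchmidt2020_thm11_lower_holds` (every `d ≥ 2`).
[cite: MaininiSchmidt2020, Theorem 1.1 (ii) with Lemma 3.5] -/
def MaininiSchmidt2020_thm11_lower : Prop :=
  ∀ d : ℕ, 2 ≤ d → ∃ K : ℝ, 0 < K ∧ ∀ ε : ℝ, 0 < ε →
    {n : ℕ | ∃ C : Finset (Site d), IsEIPMinimizer C ∧ #C = n ∧
      ∀ a : Site d,
        (K - ε) * (n : ℝ) ^ maximalFluctuationExponent d ≤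
          (#((C.image fun x => x - a) ∆ wulffCube d n) : ℝ)}.Infinite

/-- **Mainini–Schmidt 2020, Corollary 3.3, NAMED FACT.**  Every `(d−1)`-dimensional section
`S_{s,k}(C) = C ∩ {x_s = k}` (as a subset of `ℤ^{d−1}`) of an `EIP^d` minimizer `C ⊂ ℤ^d` is an
`EIP^{d−1}` minimizer (here `d = n + 1 ≥ 1`).  DISCHARGED downstream:
`GridEdgeIsoperimetry.MaininiSchmidt2020_cor33_holds` (every `d`). [cite: MaininiSchmidt2020, Corollary 3.3] -/
def MaininiSchmidt2020_cor33 : Prop :=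
  ∀ (n : ℕ) (C : Finset (Site (n + 1))), IsEIPMinimizer C →
    ∀ (s : Fin (n + 1)) (k : ℤ), IsEIPMinimizer (latticeSection s k C)

/-- **Mainini–Schmidt 2020, Lemma 3.5, NAMED FACT.**  For `d ≥ 2`, `ℓ ≥ 1` and `1 ≤ p ≤ ⌊h_{ℓ,d}⌋`,
`h_{ℓ,d} = ℓ^{2^{1−d}}` (Definition 3.1), the slab-deficient cube
`P_{ℓ,d,p} = {1,…,ℓ−p} × {1,…,ℓ}^{d−1}` is an `EIP^d` minimizer — the lower-bound construction behind
Theorem 1.1 (ii).  DISCHARGED downstream: `EIPSlabMinimizers.MaininiSchmidt2020_lemma35_holds` (every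
`d ≥ 2`). [cite: MaininiSchmidt2020, Lemma 3.5 (with Definition 3.1)] -/
def MaininiSchmidt2020_lemma35 : Prop :=
  ∀ d : ℕ, 2 ≤ d → ∀ ℓ p : ℕ, 1 ≤ ℓ → 1 ≤ p →
    p ≤ ⌊(ℓ : ℝ) ^ ((2 : ℝ) ^ (1 - (d : ℝ)))⌋₊ → IsEIPMinimizer (slabConfig d ℓ p)

/-! ### Proved bookkeeping -/

/-- The empty configuration is an `EIP^d` minimizer ("as a convention, the empty set is assumed to be
an `EIP^d` minimizer as well" — here it is automatic). [cite: MaininiSchmidt2020, §1] -/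
theorem isEIPMinimizer_empty : IsEIPMinimizer (∅ : Finset (Site d)) := by
  intro C' hC'
  rw [card_empty, card_eq_zero] at hC'
  subst hC'
  exact le_rfl

/-- A single point is an `EIP^d` minimizer (all one-point sets have edge perimeter `2d`,
`card_boundaryPairs_singleton`); in particular `IsEIPMinimizer` is satisfiable by non-empty sets.
[cite: MaininiSchmidt2020, §1] -/
theorem isEIPMinimizer_singleton (x : Site d) : IsEIPMinimizer ({x} : Finset (Site d)) := by
  intro C' hC'
  rw [card_singleton, card_eq_one] at hC'
  obtain ⟨y, rfl⟩ := hC'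
  rw [card_boundaryPairs_singleton, card_boundaryPairs_singleton]

/-- **`#(boundaryPairs C)` is the printed edge perimeter `#Θ_d(C)`**: the number of pairs `(x, y)` with
`x ∈ C`, `y ∉ C`, `x ∼ y` in `ℤ^d`, written as `Σ_{x ∈ C} #{y ∼ x : y ∉ C}`.
[cite: MaininiSchmidt2020, §1 (definition of Θ_d)] -/
theorem card_boundaryPairs_eq_sum_card_filter_neighborFinset (C : Finset (Site d)) :
    #(boundaryPairs C) = ∑ x ∈ C, #(((zdGraph d).neighborFinset x).filter fun y => y ∉ C) := by
  classical
  unfold boundaryPairs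
  rw [card_filter, sum_product]
  refine sum_congr rfl fun x _ => ?_
  rw [← card_filter, neighborFinset_zdGraph_eq_image, filter_image,
    card_image_of_injective _ (fun p q h => single_signedUnit_injective (add_left_cancel h))]
  rfl

/-- **The elementary relation `#Θ_d(C) + 2b(C) = 2d·#C`** of both sources, with
`2b(C) = #{(x, y) ∈ C × C : |x − y| = 1}` the number of ORDERED adjacent pairs of `C` (twice the
number of bonds): every point of `C` has `2d` lattice neighbours, each either outside `C` (a boundary
pair) or inside `C` (an ordered bond).  Hence minimizing the edge perimeter at fixed `#C` is the same
as maximizing the number of bonds `b(C)` — the form in which these results speak about sticky-type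
ground states ([MPSS19] §2 for `d = 3`: `#Θ(C_n) + 2b(C_n) = 6n`).
[cite: MaininiSchmidt2020, §1 (the relation #Θ_d(C) + 2b(C) = 2d #C)] -/
theorem card_boundaryPairs_add_card_adjPairs (C : Finset (Site d)) :
    #(boundaryPairs C) + #((C ×ˢ C).filter fun p => (zdGraph d).Adj p.1 p.2) = 2 * d * #C := by
  classical
  rw [card_boundaryPairs_eq_sum_card_filter_neighborFinset]
  have h2 : #((C ×ˢ C).filter fun p => (zdGraph d).Adj p.1 p.2) =
      ∑ x ∈ C, #(((zdGraph d).neighborFinset x).filter fun y => y ∈ C) := by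
    rw [card_filter, sum_product]
    refine sum_congr rfl fun x _ => ?_
    rw [← card_filter]
    congr 1
    ext y
    simp only [mem_filter, SimpleGraph.mem_neighborFinset]
    tauto
  have h3 : ∀ x ∈ C, #(((zdGraph d).neighborFinset x).filter fun y => y ∉ C) +
      #(((zdGraph d).neighborFinset x).filter fun y => y ∈ C) = 2 * d := by
    intro x _
    rw [add_comm, card_filter_add_card_filter_not]
    exact card_neighborFinset_zdGraph_holds x
  rw [h2, ← sum_add_distrib, sum_congr rfl h3, sum_const, smul_eq_mul, mul_comm]

/-- Corollary: an `EIP^d` minimizer MAXIMIZES the number of (ordered) bonds among sets of its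
cardinality ("`C_n` is a minimizer for the `EIP_n` if and only if it maximizes the number of unit
bonds", [MPSS19] §2; the converse direction is symmetric).
[cite: MaininiPiovanoSchmidtStefanelli2019, §2 (minimizers maximize the number of unit bonds)] -/
theorem IsEIPMinimizer.card_adjPairs_le {C : Finset (Site d)} (hC : IsEIPMinimizer C)
    (C' : Finset (Site d)) (h : #C' = #C) :
    #((C' ×ˢ C').filter fun p => (zdGraph d).Adj p.1 p.2) ≤
      #((C ×ˢ C).filter fun p => (zdGraph d).Adj p.1 p.2) := by
  have h1 := card_boundaryPairs_add_card_adjPairs C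
  have h2 := card_boundaryPairs_add_card_adjPairs C'
  have h3 := hC C' h
  rw [h] at h2
  omega

/-- `#W_n = ⌊n^{1/d}⌋^d` for the Mainini–Schmidt cube. [cite: MaininiSchmidt2020, §1 (W_n)] -/
theorem card_wulffCube (d n : ℕ) : #(wulffCube d n) = latticeRootFloor d n ^ d := by
  simp [wulffCube, Fintype.card_piFinset, Int.card_Icc]

/-- `#W_n = (⌊∛n⌋ + 1)³` for the Mainini–Piovano–Schmidt–Stefanelli cube `[0, ℓ_n]³ ∩ ℤ³`.
[cite: MaininiPiovanoSchmidtStefanelli2019, §1 eq. (2)] -/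
theorem card_wulffCubeZero (n : ℕ) : #(wulffCubeZero n) = (latticeRootFloor 3 n + 1) ^ 3 := by
  simp [wulffCubeZero, Fintype.card_piFinset, Int.card_Icc]

/-- `⌊n^{1/d}⌋^d ≤ n` (`d ≥ 1`): the Wulff cube never has more than `n` points.
[cite: MaininiSchmidt2020, §1 (W_n)] -/
theorem latticeRootFloor_pow_le (hd : 1 ≤ d) (n : ℕ) : latticeRootFloor d n ^ d ≤ n := by
  have hd' : (d : ℝ) ≠ 0 := by exact_mod_cast (show d ≠ 0 by omega)
  have h0 : (0 : ℝ) ≤ (n : ℝ) ^ ((1 : ℝ) / d) := Real.rpow_nonneg (Nat.cast_nonneg n) _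
  have h1 : ((latticeRootFloor d n : ℕ) : ℝ) ≤ (n : ℝ) ^ ((1 : ℝ) / d) := Nat.floor_le h0
  have h2 : (((latticeRootFloor d n : ℕ) : ℝ)) ^ d ≤ ((n : ℝ) ^ ((1 : ℝ) / d)) ^ d :=
    pow_le_pow_left₀ (Nat.cast_nonneg _) h1 d
  have h3 : ((n : ℝ) ^ ((1 : ℝ) / d)) ^ d = n := by
    rw [← Real.rpow_natCast, ← Real.rpow_mul (Nat.cast_nonneg n), one_div_mul_cancel hd',
      Real.rpow_one]
  rw [h3] at h2
  exact_mod_cast h2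

/-- `n < (⌊n^{1/d}⌋ + 1)^d` (`d ≥ 1`): together with `latticeRootFloor_pow_le`, `⌊n^{1/d}⌋` is the
integer `ℓ` with `ℓ^d ≤ n < (ℓ + 1)^d`. [cite: MaininiSchmidt2020, §1 (W_n)] -/
theorem lt_latticeRootFloor_succ_pow (hd : 1 ≤ d) (n : ℕ) : n < (latticeRootFloor d n + 1) ^ d := by
  have hd0 : d ≠ 0 := by omega
  have hd' : (d : ℝ) ≠ 0 := by exact_mod_cast hd0
  have h0 : (0 : ℝ) ≤ (n : ℝ) ^ ((1 : ℝ) / d) := Real.rpow_nonneg (Nat.cast_nonneg n) _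
  have h1 : (n : ℝ) ^ ((1 : ℝ) / d) < (latticeRootFloor d n : ℕ) + 1 := Nat.lt_floor_add_one _
  have h2 : ((n : ℝ) ^ ((1 : ℝ) / d)) ^ d < (((latticeRootFloor d n : ℕ) : ℝ) + 1) ^ d :=
    pow_lt_pow_left₀ h1 h0 hd0
  have h3 : ((n : ℝ) ^ ((1 : ℝ) / d)) ^ d = n := by
    rw [← Real.rpow_natCast, ← Real.rpow_mul (Nat.cast_nonneg n), one_div_mul_cancel hd',
      Real.rpow_one]
  rw [h3] at h2
  exact_mod_cast h2

/-- `(2 − 1 + 2^{−1})/2 = 3/4`: in the plane the Mainini–Schmidt exponent is the `n^{3/4}` law.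
[cite: MaininiSchmidt2020, p. 3 (list of exponents)] -/
theorem maximalFluctuationExponent_two : maximalFluctuationExponent 2 = 3 / 4 := by
  unfold maximalFluctuationExponent
  rw [show (1 : ℝ) - ((2 : ℕ) : ℝ) = ((-1 : ℤ) : ℝ) by norm_num, Real.rpow_intCast]
  norm_num

/-- `(3 − 1 + 2^{−2})/3 = 3/4`: in `ℤ³` the Mainini–Schmidt exponent is again `3/4`, the
`N^{3/4}` law of Mainini–Piovano–Schmidt–Stefanelli. [cite: MaininiSchmidt2020, p. 3 (list of exponents)] -/
theorem maximalFluctuationExponent_three : maximalFluctuationExponent 3 = 3 / 4 := by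
  unfold maximalFluctuationExponent
  rw [show (1 : ℝ) - ((3 : ℕ) : ℝ) = ((-2 : ℤ) : ℝ) by norm_num, Real.rpow_intCast]
  norm_num

end Literature.MathematicalPhysics.StatisticalMechanics

end
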